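import Summits.Ventures.CertifiedManyBodySolver.Observables.MottPairCurrentSelectionRuleTL
import Literature.MathematicalPhysics.QuantumLattice.HubbardPseudospinIsotropy
import HarnessLib

/-!
# The Mott-column selection rule in the thermodynamic limit, II: the CHARGE correlator of every even-torus-limit
# half-filled ground state is twice Yang's staggered on-site (`η`) pair correlator

HONEST FRAMING: an exact IDENTITY at the Mott control point `(U, n, t') = (U, 1, 0)`; no number; silent on size, sign or
decay; dictionary/control entry — not a superconductivity verdict, no phase sentence. Crew hubbard-obs (D-0042), seat
hubbard-obs-p1 (`prover-hubbard-obs-p1-g13-0`), PAIRCORR-SDP §21.5; companion of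
`Observables/MottPairCurrentSelectionRuleTL.lean` (the bond / `d`-wave rule `ω(P_x^{d⋆}P_y^d) = ½ ε_xε_y ω(J_x^{d⋆}J_y^d)`).
Zero compute; no definition; no named fact; no `sorry`.

WHAT IS PROVED (`chargeCorr_eq_two_stagger_etaPairCorr_of_isTorusLimitOf_halfFilling`): for `U > 0`, every torus limit `ω`
of unit `(L², S^z = 0)`-sector ground states of `hubbardTorusTT' L 1 0 U` along an EVEN side sequence, and all `x ≠ y`,

  `ω((n_{x↑} − c_{x↓}c†_{x↓})(n_{y↑} − c_{y↓}c†_{y↓})) = 2 ε_x ε_y ω(c†_{x↑} c†_{x↓} c_{y↓} c_{y↑})`,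

where `n_{x↑} − c_{x↓}c†_{x↓} = n_{x↑} + n_{x↓} − 1` by the CAR (written without the identity matrix on purpose) is the
charge deviation and `ε_x = (−1)^{x₁+x₂}`: the density–density (charge) correlator of the Mott control column IS Yang's
`η`-pair correlator — Zhang's on-site pseudospin triplet `(η†_x, n_x − 1, η_x)` in THE `η`-singlet half-filled ground
state (Lieb), tree `expect_chargeDev_mul_chargeDev_eq_of_eta_mulVec_eq_zero` + `hubbardTorus_eta_mulVec_eq_zero_of_isGroundState`,
transported through `IsTorusLimitOf` exactly as in part I (`torusStagger_ofTorusSite_proj`,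
`isGroundState_of_isGroundStateInSector_halfFilling`). Together with the cell's `η`-pairing exclusion at `2μ < U`
(`EtaPairingExclusionA0prime`): at the Mott point charge cells are `η`-pair cells; off it (certified bracket) the `η`-pair
channel carries no long-range order.

## References
S.-C. Zhang, PRL 65 (1990) 120 [cite: Zhang1990]; C. N. Yang, S. C. Zhang, Mod. Phys. Lett. B 4 (1990) 759, Thm. 1
[cite: YangZhang1990, Theorem 1]; E. H. Lieb, PRL 62 (1989) 1201, Thm. 2 [cite: LiebPRL1989, Theorem 2]; O. Bratteli,
D. W. Robinson, OAQSM 1 §4.3.1 [cite: BratteliRobinsonI1987, §4.3.1]. Nearest tree prior art: the torus identities of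
`HubbardPseudospinIsotropy.lean` (finite volume, THE `L²`-particle ground state); the thermodynamic-limit form is in-house.
-/

noncomputable section

namespace Summit.Ventures.CertifiedManyBodySolver.Observables

open Matrix Finset Filter Literature.MathematicalPhysics.QuantumLattice Literature.Probability.LatticeModels
open Literature.MathematicalPhysics.QuantumLattice.HubbardWave0 ThermodynamicLimit
open scoped ComplexOrder Topology

variable {U : ℝ} {ω : InfVolFermionState 2}

/-! ### The on-site companion: at the Mott point the CHARGE correlator is Yang's η-pair correlator -/

/-- CAR bookkeeping: `n_{x↑} + n_{x↓} − 1 = n_{x↑} − c_{x↓} c†_{x↓}` (so the charge deviation needs no identity matrix).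
[folklore] -/
private theorem numberOp_add_numberOp_sub_one_eq {Λ : Type*} [LinearOrder Λ] [Fintype Λ] (x : Λ) :
    (numberOp x 0 + numberOp x 1 - 1 : Matrix (Finset (Orb Λ)) (Finset (Orb Λ)) ℂ) =
      numberOp x 0 - annihilation (orb x 1) * creation (orb x 1) := by
  rw [annihilation_mul_creation, if_pos rfl, numberOp, numberOp]
  abel


/-- **THE CHARGE ↔ η-PAIR SELECTION RULE IN THE TL** (`t = 1`, `t' = 0`, `n = 1`, every `U > 0`): for every torus limit
`ω` of unit `(L², S^z = 0)`-sector ground states along an EVEN side sequence and all `x ≠ y` in `ℤ²`,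
`ω((n_x − 1)(n_y − 1)) = 2 ε_x ε_y ω(c†_{x↑}c†_{x↓} c_{y↓}c_{y↑})` (the charge deviation is written `n_{x↑} − c_{x↓}c†_{x↓} =
n_{x↑} + n_{x↓} − 1` by the CAR, so that no identity matrix enters) — the density–density (charge) correlator of the Mott
control column IS Yang's staggered on-site pair correlator (Zhang's on-site pseudospin triplet `(η†_x, n_x − 1, η_x)` in
THE `η`-singlet ground state; tree `hubbardTorus_expect_chargeDev_mul_chargeDev_eq`). So every certified charge cell at
`(U, 1, 0)` is an `η`-pair cell; an exact IDENTITY, silent on size/sign/decay; half filling, `t' = 0`, even tori only.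
[cite: Zhang1990] [cite: YangZhang1990, Theorem 1] [cite: LiebPRL1989, Theorem 2] -/
theorem chargeCorr_eq_two_stagger_etaPairCorr_of_isTorusLimitOf_halfFilling (hU : 0 < U) {Ls : ℕ → ℕ}
    (hLs : Tendsto Ls atTop atTop) (hev : ∀ j, Even (Ls j)) {ψ : ∀ L, Fock (Orb (FermionTorus 2 L))}
    (hψ : ∀ L, IsGroundStateInSector (hubbardTorusTT' L 1 0 U) (L ^ 2) 0 (ψ L))
    (hω : ω.IsTorusLimitOf ψ Ls) {x y : Site 2} (hxy : x ≠ y) :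
    ω.corr (nAt x (Finset.mem_singleton_self x) 0 -
          cAt x (Finset.mem_singleton_self x) 1 * (cAt x (Finset.mem_singleton_self x) 1)ᴴ : FermionOp {x})
        (nAt y (Finset.mem_singleton_self y) 0 -
          cAt y (Finset.mem_singleton_self y) 1 * (cAt y (Finset.mem_singleton_self y) 1)ᴴ : FermionOp {y}) =
      2 * (((siteStagger x : ℤ) : ℂ) * ((siteStagger y : ℤ) : ℂ)) *
        ω.corr ((cAt x (Finset.mem_singleton_self x) 0)ᴴ * (cAt x (Finset.mem_singleton_self x) 1)ᴴ : FermionOp {x})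
          (cAt y (Finset.mem_singleton_self y) 1 * cAt y (Finset.mem_singleton_self y) 0 : FermionOp {y}) := by
  set Qx : FermionOp {x} := nAt x (Finset.mem_singleton_self x) 0 -
    cAt x (Finset.mem_singleton_self x) 1 * (cAt x (Finset.mem_singleton_self x) 1)ᴴ with hQx
  set Qy : FermionOp {y} := nAt y (Finset.mem_singleton_self y) 0 -
    cAt y (Finset.mem_singleton_self y) 1 * (cAt y (Finset.mem_singleton_self y) 1)ᴴ with hQy
  set Ex : FermionOp {x} := (cAt x (Finset.mem_singleton_self x) 0)ᴴ * (cAt x (Finset.mem_singleton_self x) 1)ᴴ with hEx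
  set Ey : FermionOp {y} := cAt y (Finset.mem_singleton_self y) 1 * cAt y (Finset.mem_singleton_self y) 0 with hEy
  set c : ℂ := 2 * (((siteStagger x : ℤ) : ℂ) * ((siteStagger y : ℤ) : ℂ)) with hc
  set Xobs : FermionOp ({x} ∪ {y}) :=
    fermionEmbed (PolySite.incl Finset.subset_union_left) Qx * fermionEmbed (PolySite.incl Finset.subset_union_right) Qy -
      c • (fermionEmbed (PolySite.incl Finset.subset_union_left) Ex *
        fermionEmbed (PolySite.incl Finset.subset_union_right) Ey) with hXobs
  have hexp : ω.expect ({x} ∪ {y}) Xobs = ω.corr Qx Qy - c * ω.corr Ex Ey := by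
    rw [hXobs, map_sub, map_smul, smul_eq_mul, InfVolFermionState.corr_eq, InfVolFermionState.corr_eq]
  obtain ⟨L₀, hL₀⟩ := exists_forall_le_injOn_proj (({x} : Finset (Site 2)) ∪ {y})
  have hzero : ∀ᶠ j in atTop, torusAvgExpect (Ls j) ({x} ∪ {y}) Xobs (ψ (Ls j)) = 0 := by
    filter_upwards [hLs.eventually_ge_atTop (L₀ + 1)] with j hj
    haveI : NeZero (Ls j) := ⟨by omega⟩
    have hInj := hL₀ (Ls j) (by omega)
    have hx : Set.InjOn (Torus.proj (d := 2) (Ls j)) ↑({x} : Finset (Site 2)) :=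
      hInj.mono (Finset.coe_subset.2 Finset.subset_union_left)
    have hy : Set.InjOn (Torus.proj (d := 2) (Ls j)) ↑({y} : Finset (Site 2)) :=
      hInj.mono (Finset.coe_subset.2 Finset.subset_union_right)
    have hne : FermionTorus.ofTorusSite (Torus.proj (Ls j) x) ≠ FermionTorus.ofTorusSite (Torus.proj (Ls j) y) := by
      intro h
      have h1 : Torus.proj (Ls j) x = Torus.proj (Ls j) y := by
        have := congrArg FermionTorus.toTorusSite h
        rwa [FermionTorus.toTorusSite_ofTorusSite, FermionTorus.toTorusSite_ofTorusSite] at this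
      exact hxy (hInj (by simp) (by simp) h1)
    rw [torusAvgExpect_eq, torusAvgExpectAt_of_injOn (Ls j) hInj]
    have hObs : fermionEmbed (PolySite.toTorusEmb (Ls j) hInj) Xobs =
        (numberOp (FermionTorus.ofTorusSite (Torus.proj (Ls j) x)) 0 -
            annihilation (orb (FermionTorus.ofTorusSite (Torus.proj (Ls j) x)) 1) *
              creation (orb (FermionTorus.ofTorusSite (Torus.proj (Ls j) x)) 1)) *
          (numberOp (FermionTorus.ofTorusSite (Torus.proj (Ls j) y)) 0 -
            annihilation (orb (FermionTorus.ofTorusSite (Torus.proj (Ls j) y)) 1) *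
              creation (orb (FermionTorus.ofTorusSite (Torus.proj (Ls j) y)) 1)) -
          c • (creation (orb (FermionTorus.ofTorusSite (Torus.proj (Ls j) x)) 0) *
              creation (orb (FermionTorus.ofTorusSite (Torus.proj (Ls j) x)) 1) *
            (annihilation (orb (FermionTorus.ofTorusSite (Torus.proj (Ls j) y)) 1) *
              annihilation (orb (FermionTorus.ofTorusSite (Torus.proj (Ls j) y)) 0))) := by
      rw [hXobs, fermionEmbed_sub, fermionEmbed_smul, fermionEmbed_mul, fermionEmbed_mul, fermionEmbed_fermionEmbed,
        fermionEmbed_fermionEmbed, fermionEmbed_fermionEmbed, fermionEmbed_fermionEmbed,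
        fermionEmbed_congr (φ := (PolySite.incl Finset.subset_union_left).trans (PolySite.toTorusEmb (Ls j) hInj))
          (ψ := PolySite.toTorusEmb (Ls j) hx) (fun _ => rfl),
        fermionEmbed_congr (φ := (PolySite.incl Finset.subset_union_right).trans (PolySite.toTorusEmb (Ls j) hInj))
          (ψ := PolySite.toTorusEmb (Ls j) hy) (fun _ => rfl), hQx, hQy, hEx, hEy]
      simp only [fermionEmbed_sub, fermionEmbed_mul, nAt, cAt, fermionEmbed_numberOp, fermionEmbed_annihilation,
        fermionEmbed_creation, PolySite.toTorusEmb_apply, PolySite.ofLex_coe_pt, annihilation_conjTranspose]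
    rw [hObs]
    have hterm : ∀ v : TorusSite 2 (Ls j),
        Literature.MathematicalPhysics.QuantumLattice.expect ((numberOp (FermionTorus.ofTorusSite (Torus.proj (Ls j) x)) 0 -
              annihilation (orb (FermionTorus.ofTorusSite (Torus.proj (Ls j) x)) 1) *
                creation (orb (FermionTorus.ofTorusSite (Torus.proj (Ls j) x)) 1)) *
            (numberOp (FermionTorus.ofTorusSite (Torus.proj (Ls j) y)) 0 -
              annihilation (orb (FermionTorus.ofTorusSite (Torus.proj (Ls j) y)) 1) *
                creation (orb (FermionTorus.ofTorusSite (Torus.proj (Ls j) y)) 1)) -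
            c • (creation (orb (FermionTorus.ofTorusSite (Torus.proj (Ls j) x)) 0) *
                creation (orb (FermionTorus.ofTorusSite (Torus.proj (Ls j) x)) 1) *
              (annihilation (orb (FermionTorus.ofTorusSite (Torus.proj (Ls j) y)) 1) *
                annihilation (orb (FermionTorus.ofTorusSite (Torus.proj (Ls j) y)) 0))))
          ((fockTranslate v).val *ᵥ ψ (Ls j)) = 0 := by
      intro v
      have hφ : IsGroundStateInSector (hubbardTorus 2 (Ls j) 1 U) ((Ls j) ^ 2) 0 ((fockTranslate v).val *ᵥ ψ (Ls j)) := by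
        have h0 := hψ (Ls j)
        rw [hubbardTorusTT'_zero] at h0
        exact h0.fockTranslate_mulVec v (relabel_translate_hubbardTorus v 1 U)
      have hgs := isGroundState_of_isGroundStateInSector_halfFilling (hev j) 1 U hφ
      obtain ⟨hLo, hR⟩ := (hubbardTorus_eta_mulVec_eq_zero_of_isGroundState (hev j) one_ne_zero hU hgs).1
      have hid := expect_chargeDev_mul_chargeDev_eq_of_eta_mulVec_eq_zero hne (torusStagger (d := 2) (L := Ls j)) hLo hR
      rw [torusStagger_ofTorusSite_proj (hev j) x, torusStagger_ofTorusSite_proj (hev j) y, numberOp_add_numberOp_sub_one_eq,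
        numberOp_add_numberOp_sub_one_eq] at hid
      rw [Literature.MathematicalPhysics.QuantumLattice.expect, sub_mulVec, dotProduct_sub, smul_mulVec, dotProduct_smul,
        smul_eq_mul]
      change Literature.MathematicalPhysics.QuantumLattice.expect _ _ -
          c * Literature.MathematicalPhysics.QuantumLattice.expect _ _ = 0
      rw [hid, hc]
      ring
    simp only [hterm, Finset.sum_const_zero, mul_zero]
  have hlim := hω ({x} ∪ {y}) Xobs
  have h0 : ω.expect ({x} ∪ {y}) Xobs = 0 :=
    tendsto_nhds_unique hlim (tendsto_const_nhds.congr' (hzero.mono fun j hj => hj.symm))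
  rw [hexp, sub_eq_zero] at h0
  rw [h0]

end Summit.Ventures.CertifiedManyBodySolver.Observables

end
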